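import Literature.AlgebraicGeometry.HodgeTheory.NodalBranchMembers
import Mathlib.Analysis.Calculus.FDeriv.Analytic
import HarnessLib

/-!
# The branches of the discriminant through a `k`-nodal form, read in a two-parameter unfolding
# `F_{u,v} = f₁ + u g + v h` — any number of nodes

Family `hodge`, layer `Literature/AlgebraicGeometry/HodgeTheory`; sequel of `NodalBranchMembers`,
`UniversalHypersurfaceDiscriminantNodeChart` and `TwoNodalFormBranches` (Voisin II §2.1.1: node charts and branch
functions of the discriminant in the universal coefficient space). Theorems only. Written by the prover seat
`hodge-nonav-20241-p1` (g18, cell `hodge-nonav`; programme «PL1-GENERAL»: the one-node Picard–Lefschetz binder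
`picardLefschetz_oneNode` of crux K1-B, stmt-HodgeConjecture-19716, in a GENERAL pencil direction from prover-Bx's monomial
theorem by a direction homotopy — the case `k = 1` of this file gives the one smooth discriminant branch of the plane
`f₁ + u g + v g′`).

VERBATIM the statement and proof of `DiscriminantBranches.exists_twoNodal_branches` (`TwoNodalFormBranches`, `k = 2`)
for `p : Fin k → ℂⁿ⁺²`: for a form `f₁` of degree `d` with exactly the `k` ordinary double points `[pᵢ]` and forms
`g, h` of degree `d` with `g(pᵢ) ≠ 0`, the unfolding `(u, v) ↦ F_{u,v} = f₁ + u g + v h` meets the discriminant, near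
`(0,0)`, in the curves `φᵢ = 0` (`φᵢ` holomorphic near `0`, `φᵢ(0) = 0`, STRICT differential
`(u,v) ↦ u·g(pᵢ) + v·h(pᵢ)`); on a neighbourhood `N ∋ 0`, `F_{u,v}` is nonsingular iff `φᵢ(u,v) ≠ 0` for every `i`, and
a parameter on EXACTLY ONE curve gives a one-nodal member with node `zᵢ(u,v)` (continuous, `zᵢ(0) = pᵢ`) at which
`g ≠ 0`.

* `exists_nodal_branches`.

Honest scope: local structure of the discriminant only (no monodromy, no HC).

## References

* [VoisinHodgeII2003] C. Voisin, Hodge Theory and Complex Algebraic Geometry II, CUP 2003, §2.1.1 Lemma 2.7,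
  Cor. 2.8, pp. 69–70; §2.3.1.
-/

noncomputable section

open MvPolynomial
open _root_.Topology _root_.Filter Set
open Literature.AlgebraicGeometry.Motives Literature.AlgebraicGeometry.Motives.UniversalHypersurface

namespace Literature.AlgebraicGeometry.HodgeTheory

namespace DiscriminantBranches

variable {n d k : ℕ} {f₁ g h : MvPolynomial (Fin (n + 2)) ℂ} {p : Fin k → Fin (n + 2) → ℂ}

/-- **The branches of the discriminant through a `k`-nodal form in a two-parameter unfolding.** For `f₁` of
degree `d` with exactly the `k` ordinary double points `[pᵢ]`, and `g, h` of degree `d` with `g(pᵢ) ≠ 0`: there are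
functions `φᵢ : ℂ × ℂ → ℂ`, node maps `zᵢ : ℂ × ℂ → ℂⁿ⁺²` and an open `N ∋ 0` with — `φᵢ(0) = 0`; `φᵢ` has STRICT
differential `(u,v) ↦ u g(pᵢ) + v h(pᵢ)` at `0` and is differentiable on `N`; `zᵢ` is continuous at `0` with
`zᵢ(0) = pᵢ`; on `N`, `f₁ + u g + v h` is nonsingular iff `φᵢ(u,v) ≠ 0` for all `i`; and on `N`, if `φᵢ(u,v) = 0`
while `φ_{i'}(u,v) ≠ 0` (`i' ≠ i`) then `f₁ + u g + v h` is one-nodal with node `zᵢ(u,v)` and `g(zᵢ(u,v)) ≠ 0`.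
[cite: VoisinHodgeII2003, §2.1.1 Lemma 2.7, Cor. 2.8 and pp. 69–70] -/
theorem exists_nodal_branches (hf₁ : f₁.IsHomogeneous d) (hg : g.IsHomogeneous d) (hh : h.IsHomogeneous d)
    (hnod : IsNodalFormWithNodes f₁ p) (hg0 : ∀ i, eval (p i) g ≠ 0) :
    ∃ (φ : Fin k → ℂ × ℂ → ℂ) (z : Fin k → ℂ × ℂ → (Fin (n + 2) → ℂ)) (N : Set (ℂ × ℂ)),
      IsOpen N ∧ (0 : ℂ × ℂ) ∈ N ∧
      (∀ i, φ i 0 = 0) ∧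
      (∀ i, HasStrictFDerivAt (φ i)
        (eval (p i) g • ContinuousLinearMap.fst ℂ ℂ ℂ + eval (p i) h • ContinuousLinearMap.snd ℂ ℂ ℂ) 0) ∧
      (∀ i, DifferentiableOn ℂ (φ i) N) ∧
      (∀ i, ContinuousAt (z i) 0 ∧ z i 0 = p i) ∧
      (∀ q ∈ N, SmoothHypersurface.IsNonsingularForm ℂ (f₁ + q.1 • g + q.2 • h) ↔ ∀ i, φ i q ≠ 0) ∧
      (∀ q ∈ N, ∀ i, φ i q = 0 → (∀ i', i' ≠ i → φ i' q ≠ 0) →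
        IsNodalFormWithNodes (f₁ + q.1 • g + q.2 • h) ![z i q] ∧ eval (z i q) g ≠ 0) := by
  classical
  set a₁ := coeffsOf n d f₁ with ha₁
  -- the affine parameter map `a(u,v) = a₁ + u·cg + v·ch`
  set L : ℂ × ℂ →L[ℂ] (DegIndex n d → ℂ) :=
    (ContinuousLinearMap.fst ℂ ℂ ℂ).smulRight (coeffsOf n d g) +
      (ContinuousLinearMap.snd ℂ ℂ ℂ).smulRight (coeffsOf n d h) with hL
  set A : ℂ × ℂ → (DegIndex n d → ℂ) := fun q => a₁ + L q with hA
  have hLq : ∀ q : ℂ × ℂ, L q = q.1 • coeffsOf n d g + q.2 • coeffsOf n d h := fun q => rfl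
  have hA0 : A 0 = a₁ := by
    rw [hA]; dsimp only; rw [hLq]; simp
  have hAc : Continuous A := continuous_const.add L.continuous
  have hAd : HasStrictFDerivAt A L 0 := L.hasStrictFDerivAt.const_add a₁
  have hform : ∀ q : ℂ × ℂ, formOfCoeffs (A q) = f₁ + q.1 • g + q.2 • h := fun q => by
    rw [hA]; dsimp only
    rw [hLq, formOfCoeffs_add, formOfCoeffs_add, formOfCoeffs_smul, formOfCoeffs_smul,
      formOfCoeffs_coeffsOf n d hf₁, formOfCoeffs_coeffsOf n d hg, formOfCoeffs_coeffsOf n d hh, add_assoc]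
  -- node charts
  have hj₀ : ∀ i, ∃ j, p i j ≠ 0 := fun i => exists_apply_ne_zero_of_isNodal hnod i
  choose j₀ hj₀ using hj₀
  have C : ∀ i, NodeChart n d f₁ (p i) (j₀ i) := fun i =>
    (nonempty_nodeChart hf₁ (hnod.1 i) (hj₀ i)).some
  -- the open set: branch cover, one-nodal members, `g ≠ 0` at the nodes, chart domains
  obtain ⟨W, hWo, haW, hWT, hcover⟩ := exists_branchCover hf₁ hnod j₀ hj₀ C
  have hone := eventually_isNodalFormWithNodes_of_branch_only hf₁ hnod hj₀ C
  have hgne : ∀ᶠ a in 𝓝 a₁, ∀ i, eval ((C i).node a) g ≠ 0 := by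
    refine eventually_all.2 fun i => ?_
    have hc : ContinuousAt (fun a => eval ((C i).node a) g) a₁ :=
      (continuous_eval g).continuousAt.comp (((C i).analyticOnNhd_node _ (C i).mem_T).continuousAt)
    exact hc.eventually_ne (by rw [(C i).node_base]; exact hg0 i)
  obtain ⟨O, hOsub, hOo, haO⟩ := mem_nhds_iff.1 (Filter.inter_mem (hWo.mem_nhds haW) (hone.and hgne))
  refine ⟨fun i q => (C i).branchFun (A q), fun i q => (C i).node (A q), A ⁻¹' O, hOo.preimage hAc,
    by rw [Set.mem_preimage, hA0]; exact haO, fun i => ?_, fun i => ?_, fun i => ?_, fun i => ?_,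
    fun q hq => ?_, fun q hq i hi hother => ?_⟩
  · -- `φᵢ(0) = 0`
    simp only [hA0]
    exact (C i).branchFun_base hf₁ (hnod.1 i)
  · -- strict differential at `0`
    have han : AnalyticAt ℂ (C i).branchFun a₁ := (C i).analyticOnNhd_branchFun _ (C i).mem_T
    have hstr : HasStrictFDerivAt (C i).branchFun (evalCoeffCLM n d (p i)) (A 0) := by
      rw [hA0]
      have h1 := han.hasStrictFDerivAt
      rwa [((C i).hasFDerivAt_branchFun hf₁ (hnod.1 i)).fderiv] at h1
    have hcomp := hstr.comp (0 : ℂ × ℂ) hAd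
    refine hcomp.congr_fderiv (ContinuousLinearMap.ext fun q => ?_)
    have hD : (eval (p i) g • ContinuousLinearMap.fst ℂ ℂ ℂ + eval (p i) h • ContinuousLinearMap.snd ℂ ℂ ℂ) q =
        eval (p i) g * q.1 + eval (p i) h * q.2 := rfl
    rw [hD, ContinuousLinearMap.comp_apply, hLq, map_add, map_smul, map_smul, evalCoeffCLM_coeffsOf hg,
      evalCoeffCLM_coeffsOf hh, smul_eq_mul, smul_eq_mul, mul_comm q.1, mul_comm q.2]
  · -- differentiable on `N`
    intro q hq
    have hqT : A q ∈ (C i).T := hWT i (hOsub hq).1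
    have hAq : DifferentiableAt ℂ A q := ((hasFDerivAt_const a₁ q).add L.hasFDerivAt).differentiableAt
    exact (((C i).differentiableOn_branchFun _ hqT).differentiableAt
      ((C i).isOpen_T.mem_nhds hqT)).comp_differentiableWithinAt q hAq.differentiableWithinAt
  · -- the node maps
    refine ⟨?_, by simp only [hA0]; exact (C i).node_base⟩
    have h1 : ContinuousAt (C i).node (A 0) := by
      rw [hA0]; exact ((C i).analyticOnNhd_node _ (C i).mem_T).continuousAt
    exact h1.comp hAc.continuousAt
  · -- nonsingular iff off every branch
    have hqW : A q ∈ W := (hOsub hq).1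
    have h1 := hcover (A q) hqW
    rw [mem_singularCoeffs_iff, hform q] at h1
    constructor
    · intro hns
      have hno : ¬ ∃ i, (C i).branchFun (A q) = 0 := fun hex => (h1.2 hex) hns
      push Not at hno
      exact hno
    · intro hall
      by_contra hs
      obtain ⟨i, hi⟩ := h1.1 hs
      exact hall i hi
  · -- one branch only: one-nodal, `g ≠ 0` at the node
    obtain ⟨-, hone_q, hg_q⟩ := hOsub hq
    rw [← hform q]
    exact ⟨hone_q i hi hother, hg_q i⟩

end DiscriminantBranches

end Literature.AlgebraicGeometry.HodgeTheory

end
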